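import Summits.QuantumFields.YangMills.Theorems.BalabanUVNodesN15CovariantTwoGridLineProductDefectPairwise
import Summits.QuantumFields.YangMills.Theorems.BalabanUVNodesN15CovariantTwoGridDivergenceFit
import Summits.QuantumFields.YangMills.Theorems.BalabanUVNodesN15KingModelGradCellOscillationKernel
import Summits.QuantumFields.YangMills.Theorems.BalabanUVNodesN15KingModelSrcDivCellOscillation
import HarnessLib

/-!
# N15 = NE2, road (c) — PROGRAMME (PC) «[B9] Sect. C FOR THE LANDAU LETTER WITH PER-CUBE GAUGES», (PC-E-H) THE HÖLDER-NATIVE DIVERGENCE FIT, PART 3: n15-c∕344's DISPLAYED INPUT `hB`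
# PRODUCED FROM PAIRWISE LETTERS — the two-grid fit of the divergence summand from the pointwise letter, the step letter and a PAIRWISE four-point letter of the transformed fine bond
# field (no per-step second difference, no window ∕ cell-walk sum of it), `o_B = O(G) + O(η)` EXPLICIT and UNIFORM IN THE FINE SPACING (dag-n15-c g34, n15-c∕369)

Cell `pub-ymgap`, seat `pub-ymgap-dag-n15-c` (generation g34; R134 (a) seat, strategy s1 «first missing estimate»; HUMAN RULING D-0062; chair R424 venue).
`bears_on: R4∕N15 · K3⁸ SpineGivenEndpointR13SepCoPHV (stmt-QuantumFields-27366)`; filed `--kind proof --supports stmt-QuantumFields-27366 --as helper` — COUNT-NEUTRAL.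
Theorems only, 0 `def`, 0 `sorry`.  Imports BY NAME n15-c∕368 `…CovariantTwoGridLineProductDefectPairwise` (`frob_twoGridAd_apply_le_of_pairwise`), n15-c∕358 `…CovariantTwoGridDivergenceFit`
(`frob_norm_smul_add_le`, `coordMat_smul'`; through it n15-c∕357 `frob_adFourPoint_apply_le` ∕ `abs_coordMat_entry_le_of_apply_le`, n15-c∕347 `tdist_scBlk'_line_le` ∕ `exists_tdist_le_succ` ∕
`tdist_scBlk'_scShift'_symm_le` ∕ `sc_cell_tdist_le` ∕ `scShift_symm_eq_sub` ∕ `scShift'_symm_eq_sub`, n15-c∕345 `norm_sub_kingSec_kingPr_le`, n15-c∕341 `gauged_lineHol_eq_mprod` ∕ `kingSec_sub_unitVec`,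
n15-a `scBlk_mem_cvSk_of_scChi_ne_zero`) and dag-n15-e's King-model cell geometry `…KingModelGradCellOscillationKernel` (`tdistT_le_of_kingPr_eq`: a King cell has fine diameter `≤ L^r − 1`)
∕ `…KingModelSrcDivCellOscillation` (`tdistT_add_smul_unitVec_le`: `t` steps move by `≤ t`).  Nothing in the tree is modified, no landed name re-declared.

WHY (HOME memo `EVIDENCE-N15C-G33-DIVERGENCE-FIT.md` §4–§5 (H); n15-c∕368's docstring).  n15-c∕358 bounds the two places where the SECOND-ORDER regularity of the bond field enters —
the `N²` forward differences along the fine line (n15-c∕357) and King's cell walk `x′ → σ(πx′)` of `(d+1)(L^r − 1)` steps — by SUMMING a per-step second-difference letter `γ = η′³c`;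
on Hölder-`β` data (`β < 1`, what the series' proofs deliver) this costs the factor `L^{r(1−β)}` of n15-c∕360 v1.1 ∕ 364, NOT uniform in the fine spacing.  Read PAIRWISE, the Hölder
clause (9) of [Balaban1985Variational] Thm 1 bounds each of these comparisons DIRECTLY: every pair involved lies within fine distance `2L^r = 2η∕η′` (physical distance `2η ≤ 1`).  THIS FILE
re-runs 358 with pairwise letters:
* §1 ★★★ `abs_divergenceFit_entry_le_of_pairwise` — AT ONE FINE SITE `x′` over `y = πx′` (transformed bond variables `W = u′U′_μu′(·+e′_μ)ᴴ` abstracted as a function with its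
  defining equation): from the pointwise letter `η′p` and the step letter `η′²q` along the fine line `σ(y−e_μ) + te′_μ` (`t < 2L^r`), the PAIRWISE four-point letter `η′²G` between any
  two forward bonds of that line and between the backward bonds at `x′` and at `σy`, the backward step letter at `x′` and the cell oscillation `‖W(x′) − W(σy)‖ ≤ ω`:
  `|fine − coarse|_{ij} ≤ κ_e·(η′⁻²|m|(2η′²G + η′²qω + (2η′²q + ω)η′²q) + |m|(2η⁻²(2(L^r)³αβ + (L^r)²η′²G) + 2η′⁻²(L^r+1)αβ))` (`α = η′p`, `β = η′²q`) = `κ_e|m|·(4G + 2qω∕… + O(ηpq))`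
  — n15-c∕368's base-point comparison plus ONE four-point step (n15-c∕357 `frob_adFourPoint_apply_le`) from `x′` straight to `σ(πx′)` (no walk of second differences).
* §2 ★★★ `sc_hB_of_pairwiseLetters` — PER CUBE `k` on the (PC) site carriers, in the currency of n15-c∕353∕361: letters 1 and 2 on the points within block-distance `3` of the plateau
  `𝔅_k` (353's `hF1f`∕`hstep` verbatim) and the PAIRWISE four-point letter `η′²G` for pairs of such points at fine distance `≤ 2L^r`; conclusion = n15-c∕344's `hB` LITERALLY with
  `o_B` the explicit expression of §1 at `ω = (d+1)(L^r−1)η′²q` (the cell walk is used only for the FIRST-order oscillation `ω`, n15-c∕345); the pair geometry: the line pairs are `≤ 2L^r − 1`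
  apart (`tdistT_add_smul_unitVec_le`), the cell pair `(x′ − e′, σy − e′)` is `≤ 1 + (L^r − 1) + 1` apart (`tdistT_le_of_kingPr_eq` + two unit steps).

HONEST FRAMING ∕ LIMITS.  Bookkeeping over DISPLAYED letters; the pairwise letter is the form in which n15-c∕370's datum `Reg335HolderCube` ((3.35) + the printed Hölder clause (9) at one
exponent) delivers the second-order regularity (`G = (C_βξ^{−2−β}(2η)^β + 2η′(C∕ξ)(C∕ξ²))e^{5η′C∕ξ} = O(η^β)`, uniformly in `r`); nothing of [B9]∕[B11] asserted.  NE2⁺ NOT PRINTED ∕ NOT proved;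
N15 of record untouched; K3⁸ OPEN; counts of record UNMOVED (typed 28∕28 · discharged 8∕27); one finite 𝕋⁴ at fixed ε per index — NOT infinite volume, NOT OS on ℝ⁴, NOT a mass gap, NOT Clay.
Restate-immune (no Theses import).
-/

set_option autoImplicit false

noncomputable section

open scoped BigOperators Matrix Matrix.Norms.L2Operator
open Finset

namespace Summit.QuantumFields.YangMills.BalabanUVNodes.N15.Gluing

open Literature.MathematicalPhysics.QuantumFieldTheory.Balaban1983to89
open Literature.MathematicalPhysics.QuantumFieldTheory.Balaban1983to89.B5Prop11Plancherel (Tor fine unitVec)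
open Literature.MathematicalPhysics.QuantumFieldTheory.Balaban1983to89.B6UnitTorusCarrier (unitTorusGeo)
open Literature.MathematicalPhysics.QuantumFieldTheory.King1986.Torus (blockOf tdistT tdistT_triangle tdistT_symm tdistT_self tdistT_sub_unitVec_le)
open Summit.QuantumFields.YangMills.BalabanUVNodes.N15.VectorPiece (kingPr)
open Summit.QuantumFields.YangMills.BalabanUVNodes.N15.MatrixSpecies (coordMat basisConst basisConst_nonneg coordMat_sub)
open Summit.QuantumFields.YangMills.BalabanUVNodes.N15.CurvedSpecies (uN_gaugeTransformed_bond_unitary)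
open Summit.QuantumFields.YangMills.BalabanUVNodes.N15.CovAvg (mprod mprod_congr kingSec kingSec_sub_unitVec gauged_lineHol_eq_mprod conjTranspose_mprod_mul_self norm_sub_kingSec_kingPr_le
  kingPr_kingSec frob_twoGridAd_apply_le_of_pairwise frob_adFourPoint_apply_le abs_coordMat_entry_le_of_apply_le)
open Summit.QuantumFields.YangMills.BalabanUVNodes.N15.KingModel.CellOsc (tdistT_le_of_kingPr_eq)
open Summit.QuantumFields.YangMills.BalabanUVNodes.N15.KingModel.SrcDiv (tdistT_add_smul_unitVec_le)

variable {d : ℕ} {L : ℕ} [NeZero L] {mv kk r : ℕ} {hL : Odd L ∧ 1 < L}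

/-! ## §1 At a fine site: the divergence-summand fit from the pointwise, step and PAIRWISE four-point letters -/

section Site

variable {mm : Type} [Fintype mm] [DecidableEq mm] [Nonempty mm] {ι : Type} [Fintype ι] [DecidableEq ι] (e : Matrix mm mm ℂ ≃L[ℝ] (ι → ℝ))

/-- ★★★ **THE DIVERGENCE-SUMMAND FIT AT A FINE SITE FROM PAIRWISE LETTERS** (see the module docstring, §1). [cite: Balaban1985BackgroundPropagators, (3.35) p.396, (3.40) p.397, (3.50)–(3.52)
p.400 (shapes); Balaban1985Variational, Thm 1 (9) p.279 (the pairwise Hölder clause: shape); Balaban1985Averaging, (124)–(126) p.36 (pairing: shape); King1986, p.664 (pairing convention)] -/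
theorem abs_divergenceFit_entry_le_of_pairwise {u' : ScX' d L mv kk r hL → Matrix mm mm ℂ} (hu' : ∀ z, (u' z)ᴴ * u' z = 1)
    {U' : Fin (d + 1) → ScX' d L mv kk r hL → Matrix mm mm ℂ} (hU' : ∀ μ z, (U' μ z)ᴴ * U' μ z = 1) {U : Fin (d + 1) → ScX d L mv kk hL → Matrix mm mm ℂ} (μ : Fin (d + 1))
    (hpair : ∀ y, U μ y = mprod (fun t => U' μ (kingSec (cvM d L mv kk hL) L kk r y + t • unitVec (fine (L ^ r * L ^ kk) (cvM d L mv kk hL)) μ)) (L ^ r))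
    (W : ScX' d L mv kk r hL → Matrix mm mm ℂ) (hW : ∀ z, W z = u' z * U' μ z * (u' (z + unitVec (fine (L ^ r * L ^ kk) (cvM d L mv kk hL)) μ))ᴴ)
    {p q G ω : ℝ} (hp : 0 ≤ p) (hq : 0 ≤ q) (hG : 0 ≤ G) (hω : 0 ≤ ω) (x' : ScX' d L mv kk r hL)
    -- the pointwise and step letters ALONG THE FINE LINE `σ(πx′ − e_μ) + te′_μ`, `t < 2L^r`
    (hline : ∀ t, t < 2 * L ^ r → ‖W (kingSec (cvM d L mv kk hL) L kk r ((scShift d L mv kk hL μ).symm (kingPr L kk r (cvM d L mv kk hL) x')) + t • unitVec (fine (L ^ r * L ^ kk) (cvM d L mv kk hL)) μ) - 1‖ ≤ ((((L ^ r * L ^ kk : ℕ) : ℝ))⁻¹) * p ∧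
      ‖W (kingSec (cvM d L mv kk hL) L kk r ((scShift d L mv kk hL μ).symm (kingPr L kk r (cvM d L mv kk hL) x')) + t • unitVec (fine (L ^ r * L ^ kk) (cvM d L mv kk hL)) μ + unitVec (fine (L ^ r * L ^ kk) (cvM d L mv kk hL)) μ) - W (kingSec (cvM d L mv kk hL) L kk r ((scShift d L mv kk hL μ).symm (kingPr L kk r (cvM d L mv kk hL) x')) + t • unitVec (fine (L ^ r * L ^ kk) (cvM d L mv kk hL)) μ)‖ ≤ ((((L ^ r * L ^ kk : ℕ) : ℝ))⁻¹) ^ 2 * q)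
    -- the PAIRWISE four-point letter along the fine line (no per-step second difference, no window sum)
    (hlineP : ∀ t t', t + 1 < 2 * L ^ r → t' + 1 < 2 * L ^ r →
      ‖(W (kingSec (cvM d L mv kk hL) L kk r ((scShift d L mv kk hL μ).symm (kingPr L kk r (cvM d L mv kk hL) x')) + t • unitVec (fine (L ^ r * L ^ kk) (cvM d L mv kk hL)) μ + unitVec (fine (L ^ r * L ^ kk) (cvM d L mv kk hL)) μ) - W (kingSec (cvM d L mv kk hL) L kk r ((scShift d L mv kk hL μ).symm (kingPr L kk r (cvM d L mv kk hL) x')) + t • unitVec (fine (L ^ r * L ^ kk) (cvM d L mv kk hL)) μ)) - (W (kingSec (cvM d L mv kk hL) L kk r ((scShift d L mv kk hL μ).symm (kingPr L kk r (cvM d L mv kk hL) x')) + t' • unitVec (fine (L ^ r * L ^ kk) (cvM d L mv kk hL)) μ + unitVec (fine (L ^ r * L ^ kk) (cvM d L mv kk hL)) μ) - W (kingSec (cvM d L mv kk hL) L kk r ((scShift d L mv kk hL μ).symm (kingPr L kk r (cvM d L mv kk hL) x')) + t' • unitVec (fine (L ^ r * L ^ kk) (cvM d L mv kk hL)) μ))‖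 ≤ ((((L ^ r * L ^ kk : ℕ) : ℝ))⁻¹) ^ 2 * G)
    -- the PAIRWISE four-point letter between the backward bond at `x′` and the backward bond at the base point `σ(πx′)` of its King cell, the backward step
    -- letter at `x′`, and the cell oscillation `ω` between `x′` and `σ(πx′)`
    (hcell4 : ‖(W ((scShift' d L mv kk r hL μ).symm x' + unitVec (fine (L ^ r * L ^ kk) (cvM d L mv kk hL)) μ) - W ((scShift' d L mv kk r hL μ).symm x')) - (W ((scShift' d L mv kk r hL μ).symm (kingSec (cvM d L mv kk hL) L kk r (kingPr L kk r (cvM d L mv kk hL) x')) + unitVec (fine (L ^ r * L ^ kk) (cvM d L mv kk hL)) μ) - W ((scShift' d L mv kk r hL μ).symm (kingSec (cvM d L mv kk hL) L kk r (kingPr L kk r (cvM d L mv kk hL) x'))))‖ ≤ ((((L ^ r * L ^ kk : ℕ) : ℝ))⁻¹) ^ 2 * G)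
    (hcellq : ‖W ((scShift' d L mv kk r hL μ).symm x' + unitVec (fine (L ^ r * L ^ kk) (cvM d L mv kk hL)) μ) - W ((scShift' d L mv kk r hL μ).symm x')‖ ≤ ((((L ^ r * L ^ kk : ℕ) : ℝ))⁻¹) ^ 2 * q)
    (hcellω : ‖W x' - W (kingSec (cvM d L mv kk hL) L kk r (kingPr L kk r (cvM d L mv kk hL) x'))‖ ≤ ω)
    (i j : ι) :
    |((((((L ^ r * L ^ kk : ℕ) : ℝ))⁻¹)⁻¹ * ((((L ^ r * L ^ kk : ℕ) : ℝ))⁻¹)⁻¹) • (coordMat e (ContinuousLinearMap.mulLeftRight ℝ (Matrix mm mm ℂ) (u' x' * U' μ x' * (u' (scShift' d L mv kk r hL μ x'))ᴴ) (u' x' * U' μ x' * (u' (scShift' d L mv kk r hL μ x'))ᴴ)ᴴ) -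
          coordMat e (ContinuousLinearMap.mulLeftRight ℝ (Matrix mm mm ℂ) (u' ((scShift' d L mv kk r hL μ).symm x') * U' μ ((scShift' d L mv kk r hL μ).symm x') * (u' (scShift' d L mv kk r hL μ ((scShift' d L mv kk r hL μ).symm x')))ᴴ)
            (u' ((scShift' d L mv kk r hL μ).symm x') * U' μ ((scShift' d L mv kk r hL μ).symm x') * (u' (scShift' d L mv kk r hL μ ((scShift' d L mv kk r hL μ).symm x')))ᴴ)ᴴ)) -
        (((((L ^ kk : ℕ) : ℝ))⁻¹)⁻¹ * ((((L ^ kk : ℕ) : ℝ))⁻¹)⁻¹) • (coordMat e (ContinuousLinearMap.mulLeftRight ℝ (Matrix mm mm ℂ) (u' (kingSec (cvM d L mv kk hL) L kk r (kingPr L kk r (cvM d L mv kk hL) x')) * U μ (kingPr L kk r (cvM d L mv kk hL) x') * (u' (kingSec (cvM d L mv kk hL) L kk r (scShift d L mv kk hL μ (kingPr L kk r (cvM d L mv kk hL) x'))))ᴴ)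
            (u' (kingSec (cvM d L mv kk hL) L kk r (kingPr L kk r (cvM d L mv kk hL) x')) * U μ (kingPr L kk r (cvM d L mv kk hL) x') * (u' (kingSec (cvM d L mv kk hL) L kk r (scShift d L mv kk hL μ (kingPr L kk r (cvM d L mv kk hL) x'))))ᴴ)ᴴ) -
          coordMat e (ContinuousLinearMap.mulLeftRight ℝ (Matrix mm mm ℂ) (u' (kingSec (cvM d L mv kk hL) L kk r ((scShift d L mv kk hL μ).symm (kingPr L kk r (cvM d L mv kk hL) x'))) * U μ ((scShift d L mv kk hL μ).symm (kingPr L kk r (cvM d L mv kk hL) x')) *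
              (u' (kingSec (cvM d L mv kk hL) L kk r (scShift d L mv kk hL μ ((scShift d L mv kk hL μ).symm (kingPr L kk r (cvM d L mv kk hL) x')))))ᴴ)
            (u' (kingSec (cvM d L mv kk hL) L kk r ((scShift d L mv kk hL μ).symm (kingPr L kk r (cvM d L mv kk hL) x'))) * U μ ((scShift d L mv kk hL μ).symm (kingPr L kk r (cvM d L mv kk hL) x')) *
              (u' (kingSec (cvM d L mv kk hL) L kk r (scShift d L mv kk hL μ ((scShift d L mv kk hL μ).symm (kingPr L kk r (cvM d L mv kk hL) x')))))ᴴ)ᴴ))) i j| ≤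
      @basisConst ι _ (Matrix mm mm ℂ) Matrix.frobeniusNormedAddCommGroup Matrix.frobeniusNormedSpace e *
        (((L ^ r * L ^ kk : ℕ) : ℝ) ^ 2 * (Fintype.card mm * (2 * (((((L ^ r * L ^ kk : ℕ) : ℝ))⁻¹) ^ 2 * G) + ((((L ^ r * L ^ kk : ℕ) : ℝ))⁻¹) ^ 2 * q * ω + (((((L ^ r * L ^ kk : ℕ) : ℝ))⁻¹) ^ 2 * q + ω + ((((L ^ r * L ^ kk : ℕ) : ℝ))⁻¹) ^ 2 * q) * (((((L ^ r * L ^ kk : ℕ) : ℝ))⁻¹) ^ 2 * q))) +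
          Fintype.card mm * (2 * ((L ^ kk : ℕ) : ℝ) ^ 2 * (2 * ((L ^ r : ℕ) : ℝ) ^ 3 * ((((((L ^ r * L ^ kk : ℕ) : ℝ))⁻¹) * p) * (((((L ^ r * L ^ kk : ℕ) : ℝ))⁻¹) ^ 2 * q)) + ((L ^ r : ℕ) : ℝ) ^ 2 * (((((L ^ r * L ^ kk : ℕ) : ℝ))⁻¹) ^ 2 * G)) +
            2 * (((L ^ r : ℕ) : ℝ) * ((L ^ kk : ℕ) : ℝ)) ^ 2 * ((((L ^ r : ℕ) : ℝ) + 1) * (((((L ^ r * L ^ kk : ℕ) : ℝ))⁻¹) * p) * (((((L ^ r * L ^ kk : ℕ) : ℝ))⁻¹) ^ 2 * q)))) := by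
  -- carriers and numerics
  have hLpos : 0 < L := Nat.pos_of_ne_zero (NeZero.ne L)
  have hN1 : 1 ≤ L ^ r := Nat.one_le_pow _ _ hLpos
  set N : ℕ := L ^ r with hNdef
  set nf : ℝ := ((L ^ r * L ^ kk : ℕ) : ℝ) with hnfdef
  set nc : ℝ := ((L ^ kk : ℕ) : ℝ) with hncdef
  set η' : ℝ := nf⁻¹ with hη'def
  have hnf : nf = (N : ℝ) * nc := by rw [hnfdef, hNdef, hncdef, Nat.cast_mul]
  have hη'0 : 0 ≤ η' := by rw [hη'def]; positivity
  set e1 := unitVec (fine (L ^ r * L ^ kk) (cvM d L mv kk hL)) μ with he1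
  set y := kingPr L kk r (cvM d L mv kk hL) x' with hydef
  set y' := (scShift d L mv kk hL μ).symm y with hy'def
  -- the transformed fine bond variables and the fine line
  have hWu : ∀ z, (W z)ᴴ * W z = 1 := fun z => by rw [hW]; exact uN_gaugeTransformed_bond_unitary (scShift' d L mv kk r hL) u' U' hu' hU' μ z
  set T : ℕ → Matrix mm mm ℂ := fun t => W (kingSec (cvM d L mv kk hL) L kk r y' + t • e1) with hT
  -- point identities
  have hσ : kingSec (cvM d L mv kk hL) L kk r y' = kingSec (cvM d L mv kk hL) L kk r y - N • e1 := by
    rw [hy'def, scShift_symm_eq_sub, kingSec_sub_unitVec]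
  have hpt : ∀ s : ℕ, kingSec (cvM d L mv kk hL) L kk r y' + (N + s) • e1 = kingSec (cvM d L mv kk hL) L kk r y + s • e1 := fun s => by
    rw [hσ, add_nsmul]; abel
  have hptN : kingSec (cvM d L mv kk hL) L kk r y' + N • e1 = kingSec (cvM d L mv kk hL) L kk r y := by
    have h := hpt 0; rwa [add_zero, zero_smul, add_zero] at h
  have hptN1 : kingSec (cvM d L mv kk hL) L kk r y' + (N - 1) • e1 = (scShift' d L mv kk r hL μ).symm (kingSec (cvM d L mv kk hL) L kk r y) := by
    rw [scShift'_symm_eq_sub, ← hptN, add_sub_assoc]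
    congr 1
    rw [eq_sub_iff_add_eq, ← succ_nsmul, Nat.sub_add_cancel hN1]
  have hp1 : ∀ t : ℕ, kingSec (cvM d L mv kk hL) L kk r y' + (t + 1) • e1 = kingSec (cvM d L mv kk hL) L kk r y' + t • e1 + e1 := fun t => by
    rw [succ_nsmul, add_assoc]
  have hp2 : ∀ t : ℕ, kingSec (cvM d L mv kk hL) L kk r y' + (t + 2) • e1 = kingSec (cvM d L mv kk hL) L kk r y' + t • e1 + e1 + e1 := fun t => by
    rw [show t + 2 = t + 1 + 1 from rfl, hp1, hp1]
  -- the letters of the line factors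
  have hTu : ∀ t, t < 2 * N → (T t)ᴴ * T t = 1 := fun t _ => hWu _
  have hα : ∀ t, t < 2 * N → ‖T t - 1‖ ≤ η' * p := fun t ht => (hline t ht).1
  have hβ : ∀ t, t + 1 < 2 * N → ‖T (t + 1) - T t‖ ≤ η' ^ 2 * q := fun t ht => by
    have h := (hline t (by omega)).2
    simp only [hT, hp1]
    exact h
  have hΓ : ∀ t t', t + 1 < 2 * N → t' + 1 < 2 * N → ‖(T (t + 1) - T t) - (T (t' + 1) - T t')‖ ≤ η' ^ 2 * G := fun t t' ht ht' => by
    have h := hlineP t t' (by omega) (by omega)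
    simp only [hT, hp1]
    exact h
  -- the coarse transformed bond variables ARE the line products (n15-c∕341)
  have hcc : u' (kingSec (cvM d L mv kk hL) L kk r y) * U μ y * (u' (kingSec (cvM d L mv kk hL) L kk r (scShift d L mv kk hL μ y)))ᴴ = mprod (fun t => T (N + t)) N := by
    rw [hpair y, show scShift d L mv kk hL μ y = y + unitVec (fine (L ^ kk) (cvM d L mv kk hL)) μ from rfl, gauged_lineHol_eq_mprod (cvM d L mv kk hL) L kk r hu' U' μ y]
    refine mprod_congr fun t _ => ?_
    simp only [hT, hpt t, hW, ← he1]
  have hdd : u' (kingSec (cvM d L mv kk hL) L kk r y') * U μ y' * (u' (kingSec (cvM d L mv kk hL) L kk r (scShift d L mv kk hL μ y')))ᴴ = mprod T N := by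
    rw [hpair y', show scShift d L mv kk hL μ y' = y' + unitVec (fine (L ^ kk) (cvM d L mv kk hL)) μ from rfl, gauged_lineHol_eq_mprod (cvM d L mv kk hL) L kk r hu' U' μ y']
    refine mprod_congr fun t _ => ?_
    simp only [hT, hW, ← he1]
  -- the fine quantity as a function on fine sites (for a fixed test matrix) and its step on the King cell of `x′`
  have hm0 : (0 : ℝ) ≤ Fintype.card mm := Nat.cast_nonneg _
  have hκ0 := @basisConst_nonneg ι _ (Matrix mm mm ℂ) Matrix.frobeniusNormedAddCommGroup Matrix.frobeniusNormedSpace e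
  -- rewrite the left side as ONE coordinate matrix
  rw [inv_inv, inv_inv, ← coordMat_sub, ← coordMat_sub, ← coordMat_smul', ← coordMat_smul', ← coordMat_sub]
  refine abs_coordMat_entry_le_of_apply_le e _ (by positivity) (fun X => ?_) i j
  -- pointwise Frobenius bound for the test matrix `X`
  set XF := @Norm.norm _ Matrix.frobeniusSeminormedAddCommGroup.toNorm X with hXF
  have hXF0 : 0 ≤ XF := @norm_nonneg _ Matrix.frobeniusSeminormedAddCommGroup.toSeminormedAddGroup X
  set g : ScX' d L mv kk r hL → Matrix mm mm ℂ := fun z => W z * X * (W z)ᴴ - W ((scShift' d L mv kk r hL μ).symm z) * X * (W ((scShift' d L mv kk r hL μ).symm z))ᴴ with hg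
  -- (1) the four points `a = W x′`, `b = W(x′ − e′)`, `c = W(σy)`, `d = W(σy − e′)`: the DIRECT four-point comparison (no cell walk)
  have e0 : (scShift' d L mv kk r hL μ).symm x' + e1 = x' := by rw [scShift'_symm_eq_sub, sub_add_cancel]
  have e0' : (scShift' d L mv kk r hL μ).symm (kingSec (cvM d L mv kk hL) L kk r y) + e1 = kingSec (cvM d L mv kk hL) L kk r y := by rw [scShift'_symm_eq_sub, sub_add_cancel]
  rw [e0, e0'] at hcell4
  rw [e0] at hcellq
  have hx₀' : (scShift' d L mv kk r hL μ).symm (kingSec (cvM d L mv kk hL) L kk r y) = kingSec (cvM d L mv kk hL) L kk r y' + (N - 1) • e1 := hptN1.symm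
  have hTN : T N = W (kingSec (cvM d L mv kk hL) L kk r y) := by simp only [hT, hptN]
  have hTN1 : T (N - 1) = W ((scShift' d L mv kk r hL μ).symm (kingSec (cvM d L mv kk hL) L kk r y)) := by simp only [hT, hx₀']
  have hcd : ‖W (kingSec (cvM d L mv kk hL) L kk r y) - W ((scShift' d L mv kk r hL μ).symm (kingSec (cvM d L mv kk hL) L kk r y))‖ ≤ η' ^ 2 * q := by
    have h := hβ (N - 1) (by omega)
    rw [show N - 1 + 1 = N by omega, hTN, hTN1] at h
    exact h
  have hbd : ‖W ((scShift' d L mv kk r hL μ).symm x') - W ((scShift' d L mv kk r hL μ).symm (kingSec (cvM d L mv kk hL) L kk r y))‖ ≤ η' ^ 2 * q + ω + η' ^ 2 * q := by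
    have e : W ((scShift' d L mv kk r hL μ).symm x') - W ((scShift' d L mv kk r hL μ).symm (kingSec (cvM d L mv kk hL) L kk r y)) =
        -(W x' - W ((scShift' d L mv kk r hL μ).symm x')) + (W x' - W (kingSec (cvM d L mv kk hL) L kk r y)) +
          (W (kingSec (cvM d L mv kk hL) L kk r y) - W ((scShift' d L mv kk r hL μ).symm (kingSec (cvM d L mv kk hL) L kk r y))) := by abel
    rw [e]
    refine (norm_add₃_le).trans ?_
    rw [norm_neg]
    exact add_le_add (add_le_add hcellq hcellω) hcd
  have h4 : ‖W x' - W ((scShift' d L mv kk r hL μ).symm x') - W (kingSec (cvM d L mv kk hL) L kk r y) + W ((scShift' d L mv kk r hL μ).symm (kingSec (cvM d L mv kk hL) L kk r y))‖ ≤ η' ^ 2 * G := by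
    have e : W x' - W ((scShift' d L mv kk r hL μ).symm x') - W (kingSec (cvM d L mv kk hL) L kk r y) + W ((scShift' d L mv kk r hL μ).symm (kingSec (cvM d L mv kk hL) L kk r y)) =
        (W x' - W ((scShift' d L mv kk r hL μ).symm x')) - (W (kingSec (cvM d L mv kk hL) L kk r y) - W ((scShift' d L mv kk r hL μ).symm (kingSec (cvM d L mv kk hL) L kk r y))) := by abel
    rw [e]; exact hcell4
  set b1 : ℝ := Fintype.card mm * (2 * (η' ^ 2 * G) + η' ^ 2 * q * ω + (η' ^ 2 * q + ω + η' ^ 2 * q) * (η' ^ 2 * q)) * XF with hb1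
  have hwalk : @Norm.norm _ Matrix.frobeniusSeminormedAddCommGroup.toNorm (g x' - g (kingSec (cvM d L mv kk hL) L kk r y)) ≤ b1 := by
    have hid : g x' - g (kingSec (cvM d L mv kk hL) L kk r y) =
        W x' * X * (W x')ᴴ - W ((scShift' d L mv kk r hL μ).symm x') * X * (W ((scShift' d L mv kk r hL μ).symm x'))ᴴ -
          W (kingSec (cvM d L mv kk hL) L kk r y) * X * (W (kingSec (cvM d L mv kk hL) L kk r y))ᴴ +
          W ((scShift' d L mv kk r hL μ).symm (kingSec (cvM d L mv kk hL) L kk r y)) * X * (W ((scShift' d L mv kk r hL μ).symm (kingSec (cvM d L mv kk hL) L kk r y)))ᴴ := by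
      simp only [hg]; abel
    rw [hid]
    refine (frob_adFourPoint_apply_le (hWu x') (hWu _) X).trans ?_
    have hXF' : @Norm.norm _ Matrix.frobeniusSeminormedAddCommGroup.toNorm X = XF := rfl
    rw [hXF', hb1]
    have hq2 : 0 ≤ η' ^ 2 * q := by positivity
    refine mul_le_mul_of_nonneg_right (mul_le_mul_of_nonneg_left ?_ hm0) hXF0
    exact add_le_add (add_le_add (mul_le_mul_of_nonneg_left h4 zero_le_two) (mul_le_mul hcd hcellω (norm_nonneg _) hq2)) (mul_le_mul hbd hcellq (norm_nonneg _) (by positivity))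
  -- (2) the base-point comparison (n15-c∕357)
  have hbase := frob_twoGridAd_apply_le_of_pairwise T hN1 hTu (mul_nonneg hη'0 hp) (by positivity : 0 ≤ η' ^ 2 * q) (by positivity : 0 ≤ η' ^ 2 * G) hα hβ hΓ nc X
  rw [← hcc, ← hdd] at hbase
  -- (3) the splitting of the combination applied to `X`
  have happly : ((nf * nf) • (ContinuousLinearMap.mulLeftRight ℝ (Matrix mm mm ℂ) (u' x' * U' μ x' * (u' (scShift' d L mv kk r hL μ x'))ᴴ) (u' x' * U' μ x' * (u' (scShift' d L mv kk r hL μ x'))ᴴ)ᴴ -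
        ContinuousLinearMap.mulLeftRight ℝ (Matrix mm mm ℂ) (u' ((scShift' d L mv kk r hL μ).symm x') * U' μ ((scShift' d L mv kk r hL μ).symm x') * (u' (scShift' d L mv kk r hL μ ((scShift' d L mv kk r hL μ).symm x')))ᴴ)
          (u' ((scShift' d L mv kk r hL μ).symm x') * U' μ ((scShift' d L mv kk r hL μ).symm x') * (u' (scShift' d L mv kk r hL μ ((scShift' d L mv kk r hL μ).symm x')))ᴴ)ᴴ) -
      (nc * nc) • (ContinuousLinearMap.mulLeftRight ℝ (Matrix mm mm ℂ) (u' (kingSec (cvM d L mv kk hL) L kk r y) * U μ y * (u' (kingSec (cvM d L mv kk hL) L kk r (scShift d L mv kk hL μ y)))ᴴ)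
          (u' (kingSec (cvM d L mv kk hL) L kk r y) * U μ y * (u' (kingSec (cvM d L mv kk hL) L kk r (scShift d L mv kk hL μ y)))ᴴ)ᴴ -
        ContinuousLinearMap.mulLeftRight ℝ (Matrix mm mm ℂ) (u' (kingSec (cvM d L mv kk hL) L kk r y') * U μ y' * (u' (kingSec (cvM d L mv kk hL) L kk r (scShift d L mv kk hL μ y')))ᴴ)
          (u' (kingSec (cvM d L mv kk hL) L kk r y') * U μ y' * (u' (kingSec (cvM d L mv kk hL) L kk r (scShift d L mv kk hL μ y')))ᴴ)ᴴ)) X =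
      (nf * nf) • (g x' - g (kingSec (cvM d L mv kk hL) L kk r y)) +
        (((N : ℝ) * nc) ^ 2 • (T N * X * (T N)ᴴ - T (N - 1) * X * (T (N - 1))ᴴ) -
          nc ^ 2 • (u' (kingSec (cvM d L mv kk hL) L kk r y) * U μ y * (u' (kingSec (cvM d L mv kk hL) L kk r (scShift d L mv kk hL μ y)))ᴴ * X * (u' (kingSec (cvM d L mv kk hL) L kk r y) * U μ y * (u' (kingSec (cvM d L mv kk hL) L kk r (scShift d L mv kk hL μ y)))ᴴ)ᴴ -
            u' (kingSec (cvM d L mv kk hL) L kk r y') * U μ y' * (u' (kingSec (cvM d L mv kk hL) L kk r (scShift d L mv kk hL μ y')))ᴴ * X * (u' (kingSec (cvM d L mv kk hL) L kk r y') * U μ y' * (u' (kingSec (cvM d L mv kk hL) L kk r (scShift d L mv kk hL μ y')))ᴴ)ᴴ)) := by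
    have eS : ∀ z : ScX' d L mv kk r hL, scShift' d L mv kk r hL μ z = z + e1 := fun z => rfl
    rw [← hnf, hTN, hTN1, sq, sq]
    simp only [sub_apply, smul_apply, ContinuousLinearMap.mulLeftRight_apply, hg, hW, eS]
    simp only [smul_sub]
    abel
  rw [happly]
  -- (4) the two bounds combined
  refine (frob_norm_smul_add_le (mul_nonneg (by positivity) (by positivity) : (0 : ℝ) ≤ nf * nf) _ _).trans ?_
  calc nf * nf * @Norm.norm _ Matrix.frobeniusSeminormedAddCommGroup.toNorm (g x' - g (kingSec (cvM d L mv kk hL) L kk r y)) +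
        @Norm.norm _ Matrix.frobeniusSeminormedAddCommGroup.toNorm (((N : ℝ) * nc) ^ 2 • (T N * X * (T N)ᴴ - T (N - 1) * X * (T (N - 1))ᴴ) -
          nc ^ 2 • (u' (kingSec (cvM d L mv kk hL) L kk r y) * U μ y * (u' (kingSec (cvM d L mv kk hL) L kk r (scShift d L mv kk hL μ y)))ᴴ * X * (u' (kingSec (cvM d L mv kk hL) L kk r y) * U μ y * (u' (kingSec (cvM d L mv kk hL) L kk r (scShift d L mv kk hL μ y)))ᴴ)ᴴ -
            u' (kingSec (cvM d L mv kk hL) L kk r y') * U μ y' * (u' (kingSec (cvM d L mv kk hL) L kk r (scShift d L mv kk hL μ y')))ᴴ * X * (u' (kingSec (cvM d L mv kk hL) L kk r y') * U μ y' * (u' (kingSec (cvM d L mv kk hL) L kk r (scShift d L mv kk hL μ y')))ᴴ)ᴴ))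
      ≤ nf * nf * b1 +
        Fintype.card mm * (2 * nc ^ 2 * (2 * (N : ℝ) ^ 3 * ((η' * p) * (η' ^ 2 * q)) + (N : ℝ) ^ 2 * (η' ^ 2 * G)) + 2 * ((N : ℝ) * nc) ^ 2 * (((N : ℝ) + 1) * (η' * p) * (η' ^ 2 * q))) * XF :=
        add_le_add (mul_le_mul_of_nonneg_left hwalk (by positivity)) hbase
    _ = _ := by rw [hb1, hNdef, hncdef, hnfdef]; push_cast; ring


end Site

/-! ## §2 Per cube on the (PC) site carriers: n15-c∕344's `hB` PRODUCED from pairwise letters -/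

section Cubes

variable (hM : ∀ ν, cvM d L mv kk hL ν = 2 * L * L ^ mv) (hm₁ : 2 * L ^ mv ≤ coverMargin L mv) (hfitI : coverMargin L mv - 2 * L ^ mv + (6 * L ^ mv + 1) ≤ L * L ^ mv)
  (hS0 : L * L ^ mv ≤ 2 * L * L ^ mv)

include hM hm₁ hfitI hS0 in
/-- ★★★ **n15-c∕344's DISPLAYED INPUT `hB` PRODUCED FROM PAIRWISE LETTERS** (see the module docstring, §2): per cube `k`, unitary fine gauges `u′_k`, a unitary fine bond field `U′`, the
coarse field `U_μ = Π_{t<L^r}U′_μ(σ· + te′_μ)` (covariant pairing), the pointwise letter `p` and the all-direction step letter `q` of the transformed bond variables at the fine sites within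
three blocks of the plateau `𝔅_k` (n15-c∕353's `hF1f`∕`hstep` currency) and the PAIRWISE four-point letter `η′²G` for two such sites at fine distance `≤ 2L^r` ⟹ 344's `hB` with
`o_B = κ_e·(η′⁻²|m|(2η′²G + η′²qω + (2η′²q + ω)η′²q) + |m|(2η⁻²(2(L^r)³αβ + (L^r)²η′²G) + 2η′⁻²(L^r+1)αβ))`, `α = η′p`, `β = η′²q`, `ω = (d+1)(L^r−1)η′²q` — `O(G) + O(η)`, uniform in `r`
when `G` is.
[cite: Balaban1985BackgroundPropagators, (3.35)–(3.36) p.396, (3.50)–(3.52) p.400 (shapes); Balaban1985Variational, Thm 1 (9) p.279 (shape); Balaban1985Averaging, (124)–(126) p.36 (pairing: shape); King1986, p.664 (pairing convention)] -/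
theorem sc_hB_of_pairwiseLetters {mm : Type} [Fintype mm] [DecidableEq mm] [Nonempty mm] {ι : Type} [Fintype ι] [DecidableEq ι] (e : Matrix mm mm ℂ ≃L[ℝ] (ι → ℝ))
    (u' : (Fin (d + 1) → ZMod (2 * L)) → ScX' d L mv kk r hL → Matrix mm mm ℂ) (hu' : ∀ k z, (u' k z)ᴴ * u' k z = 1)
    (U' : Fin (d + 1) → ScX' d L mv kk r hL → Matrix mm mm ℂ) (hU' : ∀ μ z, (U' μ z)ᴴ * U' μ z = 1) (U : Fin (d + 1) → ScX d L mv kk hL → Matrix mm mm ℂ)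
    (hpair : ∀ μ y, U μ y = mprod (fun t => U' μ (kingSec (cvM d L mv kk hL) L kk r y + t • unitVec (fine (L ^ r * L ^ kk) (cvM d L mv kk hL)) μ)) (L ^ r))
    {p q G : ℝ} (hp : 0 ≤ p) (hq : 0 ≤ q) (hG : 0 ≤ G)
    (hF1 : ∀ k μ (z : ScX' d L mv kk r hL), (∃ y ∈ cvSk d L mv kk hL k, (unitTorusGeo L kk (cvM d L mv kk hL)).dist (scBlk' d L mv kk r hL z) y ≤ 3) →
      ‖u' k z * U' μ z * (u' k (scShift' d L mv kk r hL μ z))ᴴ - 1‖ ≤ ((((L ^ r * L ^ kk : ℕ) : ℝ))⁻¹) * p)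
    (hF2 : ∀ k κ μ (z : ScX' d L mv kk r hL), (∃ y ∈ cvSk d L mv kk hL k, (unitTorusGeo L kk (cvM d L mv kk hL)).dist (scBlk' d L mv kk r hL z) y ≤ 3) →
      ‖u' k (z + unitVec (fine (L ^ r * L ^ kk) (cvM d L mv kk hL)) κ) * U' μ (z + unitVec (fine (L ^ r * L ^ kk) (cvM d L mv kk hL)) κ) * (u' k ((z + unitVec (fine (L ^ r * L ^ kk) (cvM d L mv kk hL)) κ) + unitVec (fine (L ^ r * L ^ kk) (cvM d L mv kk hL)) μ))ᴴ -
        (u' k z * U' μ z * (u' k (z + unitVec (fine (L ^ r * L ^ kk) (cvM d L mv kk hL)) μ))ᴴ)‖ ≤ ((((L ^ r * L ^ kk : ℕ) : ℝ))⁻¹) ^ 2 * q)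
    (hH : ∀ k μ (z z' : ScX' d L mv kk r hL), (∃ y ∈ cvSk d L mv kk hL k, (unitTorusGeo L kk (cvM d L mv kk hL)).dist (scBlk' d L mv kk r hL z) y ≤ 3) → (∃ y ∈ cvSk d L mv kk hL k, (unitTorusGeo L kk (cvM d L mv kk hL)).dist (scBlk' d L mv kk r hL z') y ≤ 3) →
      tdistT (fine (L ^ r * L ^ kk) (cvM d L mv kk hL)) z z' ≤ 2 * ((L ^ r : ℕ) : ℝ) →
      ‖(u' k (z + unitVec (fine (L ^ r * L ^ kk) (cvM d L mv kk hL)) μ) * U' μ (z + unitVec (fine (L ^ r * L ^ kk) (cvM d L mv kk hL)) μ) * (u' k (z + unitVec (fine (L ^ r * L ^ kk) (cvM d L mv kk hL)) μ + unitVec (fine (L ^ r * L ^ kk) (cvM d L mv kk hL)) μ))ᴴ - u' k z * U' μ z * (u' k (z + unitVec (fine (L ^ r * L ^ kk) (cvM d L mv kk hL)) μ))ᴴ) -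
        (u' k (z' + unitVec (fine (L ^ r * L ^ kk) (cvM d L mv kk hL)) μ) * U' μ (z' + unitVec (fine (L ^ r * L ^ kk) (cvM d L mv kk hL)) μ) * (u' k (z' + unitVec (fine (L ^ r * L ^ kk) (cvM d L mv kk hL)) μ + unitVec (fine (L ^ r * L ^ kk) (cvM d L mv kk hL)) μ))ᴴ - u' k z' * U' μ z' * (u' k (z' + unitVec (fine (L ^ r * L ^ kk) (cvM d L mv kk hL)) μ))ᴴ)‖ ≤ ((((L ^ r * L ^ kk : ℕ) : ℝ))⁻¹) ^ 2 * G) :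
    ∀ k μ x', scChi d L mv kk hL k (kingPr L kk r (cvM d L mv kk hL) x') ≠ 0 → ∀ i j : ι,
      |((((((L ^ r * L ^ kk : ℕ) : ℝ))⁻¹)⁻¹ * ((((L ^ r * L ^ kk : ℕ) : ℝ))⁻¹)⁻¹) • (coordMat e (ContinuousLinearMap.mulLeftRight ℝ (Matrix mm mm ℂ) (u' k x' * U' μ x' * (u' k (scShift' d L mv kk r hL μ x'))ᴴ) (u' k x' * U' μ x' * (u' k (scShift' d L mv kk r hL μ x'))ᴴ)ᴴ) -
            coordMat e (ContinuousLinearMap.mulLeftRight ℝ (Matrix mm mm ℂ) (u' k ((scShift' d L mv kk r hL μ).symm x') * U' μ ((scShift' d L mv kk r hL μ).symm x') * (u' k (scShift' d L mv kk r hL μ ((scShift' d L mv kk r hL μ).symm x')))ᴴ)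
              (u' k ((scShift' d L mv kk r hL μ).symm x') * U' μ ((scShift' d L mv kk r hL μ).symm x') * (u' k (scShift' d L mv kk r hL μ ((scShift' d L mv kk r hL μ).symm x')))ᴴ)ᴴ)) -
          (((((L ^ kk : ℕ) : ℝ))⁻¹)⁻¹ * ((((L ^ kk : ℕ) : ℝ))⁻¹)⁻¹) • (coordMat e (ContinuousLinearMap.mulLeftRight ℝ (Matrix mm mm ℂ) (u' k (kingSec (cvM d L mv kk hL) L kk r (kingPr L kk r (cvM d L mv kk hL) x')) * U μ (kingPr L kk r (cvM d L mv kk hL) x') * (u' k (kingSec (cvM d L mv kk hL) L kk r (scShift d L mv kk hL μ (kingPr L kk r (cvM d L mv kk hL) x'))))ᴴ)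
              (u' k (kingSec (cvM d L mv kk hL) L kk r (kingPr L kk r (cvM d L mv kk hL) x')) * U μ (kingPr L kk r (cvM d L mv kk hL) x') * (u' k (kingSec (cvM d L mv kk hL) L kk r (scShift d L mv kk hL μ (kingPr L kk r (cvM d L mv kk hL) x'))))ᴴ)ᴴ) -
            coordMat e (ContinuousLinearMap.mulLeftRight ℝ (Matrix mm mm ℂ) (u' k (kingSec (cvM d L mv kk hL) L kk r ((scShift d L mv kk hL μ).symm (kingPr L kk r (cvM d L mv kk hL) x'))) * U μ ((scShift d L mv kk hL μ).symm (kingPr L kk r (cvM d L mv kk hL) x')) *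
                (u' k (kingSec (cvM d L mv kk hL) L kk r (scShift d L mv kk hL μ ((scShift d L mv kk hL μ).symm (kingPr L kk r (cvM d L mv kk hL) x')))))ᴴ)
              (u' k (kingSec (cvM d L mv kk hL) L kk r ((scShift d L mv kk hL μ).symm (kingPr L kk r (cvM d L mv kk hL) x'))) * U μ ((scShift d L mv kk hL μ).symm (kingPr L kk r (cvM d L mv kk hL) x')) *
                (u' k (kingSec (cvM d L mv kk hL) L kk r (scShift d L mv kk hL μ ((scShift d L mv kk hL μ).symm (kingPr L kk r (cvM d L mv kk hL) x')))))ᴴ)ᴴ))) i j| ≤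
        @basisConst ι _ (Matrix mm mm ℂ) Matrix.frobeniusNormedAddCommGroup Matrix.frobeniusNormedSpace e *
          (((L ^ r * L ^ kk : ℕ) : ℝ) ^ 2 * (Fintype.card mm * (2 * (((((L ^ r * L ^ kk : ℕ) : ℝ))⁻¹) ^ 2 * G) + ((((L ^ r * L ^ kk : ℕ) : ℝ))⁻¹) ^ 2 * q * (((d + 1 : ℕ) : ℝ) * (((L ^ r - 1 : ℕ) : ℝ) * (((((L ^ r * L ^ kk : ℕ) : ℝ))⁻¹) ^ 2 * q))) + (((((L ^ r * L ^ kk : ℕ) : ℝ))⁻¹) ^ 2 * q + (((d + 1 : ℕ) : ℝ) * (((L ^ r - 1 : ℕ) : ℝ) * (((((L ^ r * L ^ kk : ℕ) : ℝ))⁻¹) ^ 2 * q))) + ((((L ^ r * L ^ kk : ℕ) : ℝ))⁻¹) ^ 2 * q) * (((((L ^ r * L ^ kk : ℕ) : ℝ))⁻¹) ^ 2 * q))) +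
            Fintype.card mm * (2 * ((L ^ kk : ℕ) : ℝ) ^ 2 * (2 * ((L ^ r : ℕ) : ℝ) ^ 3 * ((((((L ^ r * L ^ kk : ℕ) : ℝ))⁻¹) * p) * (((((L ^ r * L ^ kk : ℕ) : ℝ))⁻¹) ^ 2 * q)) + ((L ^ r : ℕ) : ℝ) ^ 2 * (((((L ^ r * L ^ kk : ℕ) : ℝ))⁻¹) ^ 2 * G)) +
              2 * (((L ^ r : ℕ) : ℝ) * ((L ^ kk : ℕ) : ℝ)) ^ 2 * ((((L ^ r : ℕ) : ℝ) + 1) * (((((L ^ r * L ^ kk : ℕ) : ℝ))⁻¹) * p) * (((((L ^ r * L ^ kk : ℕ) : ℝ))⁻¹) ^ 2 * q)))) := by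
  have hLpos : 0 < L := Nat.pos_of_ne_zero (NeZero.ne L)
  have hLr : 0 < L ^ r := pow_pos hLpos r
  intro k μ x' hχ i j
  -- block-distance bookkeeping
  have hB0 : scBlk d L mv kk hL (kingPr L kk r (cvM d L mv kk hL) x') ∈ cvSk d L mv kk hL k := scBlk_mem_cvSk_of_scChi_ne_zero hM hm₁ hfitI hS0 hχ
  have hblk : ∀ z : ScX' d L mv kk r hL, scBlk' d L mv kk r hL z = scBlk d L mv kk hL (kingPr L kk r (cvM d L mv kk hL) z) :=
    fun z => (CovAvg.blockOf_kingPr (L := L) (k := kk) (m := r) (M := cvM d L mv kk hL) z).symm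
  have hmono : ∀ (z : ScX' d L mv kk r hL) (a b : ℝ), a ≤ b → (∃ y ∈ cvSk d L mv kk hL k, (unitTorusGeo L kk (cvM d L mv kk hL)).dist (scBlk' d L mv kk r hL z) y ≤ a) →
      ∃ y ∈ cvSk d L mv kk hL k, (unitTorusGeo L kk (cvM d L mv kk hL)).dist (scBlk' d L mv kk r hL z) y ≤ b := fun z a b hab ⟨y, hy, hd⟩ => ⟨y, hy, hd.trans hab⟩
  -- the fine line `σ(πx′ − e_μ) + te′_μ`, `t < 2L^r`, stays within one block of `B(πx′)`
  have hlineP : ∀ t, t < 2 * L ^ r → ∃ y ∈ cvSk d L mv kk hL k, (unitTorusGeo L kk (cvM d L mv kk hL)).dist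
      (scBlk' d L mv kk r hL (kingSec (cvM d L mv kk hL) L kk r ((scShift d L mv kk hL μ).symm (kingPr L kk r (cvM d L mv kk hL) x')) + t • unitVec (fine (L ^ r * L ^ kk) (cvM d L mv kk hL)) μ)) y ≤ 1 := by
    intro t ht
    refine ⟨_, hB0, ?_⟩
    by_cases hlt : t < L ^ r
    · have e1 : kingSec (cvM d L mv kk hL) L kk r ((scShift d L mv kk hL μ).symm (kingPr L kk r (cvM d L mv kk hL) x')) + t • unitVec (fine (L ^ r * L ^ kk) (cvM d L mv kk hL)) μ =
          kingSec (cvM d L mv kk hL) L kk r (kingPr L kk r (cvM d L mv kk hL) x') + t • unitVec (fine (L ^ r * L ^ kk) (cvM d L mv kk hL)) μ - (L ^ r) • unitVec (fine (L ^ r * L ^ kk) (cvM d L mv kk hL)) μ := by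
        rw [scShift_symm_eq_sub, kingSec_sub_unitVec]; abel
      rw [e1]; exact tdist_scBlk'_line_le μ _ hlt le_rfl
    · have e1 : kingSec (cvM d L mv kk hL) L kk r ((scShift d L mv kk hL μ).symm (kingPr L kk r (cvM d L mv kk hL) x')) + t • unitVec (fine (L ^ r * L ^ kk) (cvM d L mv kk hL)) μ =
          kingSec (cvM d L mv kk hL) L kk r (kingPr L kk r (cvM d L mv kk hL) x') + (t - L ^ r) • unitVec (fine (L ^ r * L ^ kk) (cvM d L mv kk hL)) μ - (0 : ℕ) • unitVec (fine (L ^ r * L ^ kk) (cvM d L mv kk hL)) μ := by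
        rw [scShift_symm_eq_sub, kingSec_sub_unitVec, zero_smul, sub_zero, sub_add_eq_add_sub, sub_eq_iff_eq_add, add_assoc, ← add_nsmul, Nat.sub_add_cancel (le_of_not_gt hlt)]
      rw [e1]; exact tdist_scBlk'_line_le μ _ (by omega) (Nat.zero_le _)
  -- the fine spacing and the transformed bond variables of this cube gauge
  have hN1 : 1 ≤ L ^ r := Nat.one_le_pow _ _ hLpos
  set W : ScX' d L mv kk r hL → Matrix mm mm ℂ := fun z => u' k z * U' μ z * (u' k (z + unitVec (fine (L ^ r * L ^ kk) (cvM d L mv kk hL)) μ))ᴴ with hW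
  have hη2q : 0 ≤ ((((L ^ r * L ^ kk : ℕ) : ℝ))⁻¹) ^ 2 * q := by positivity
  -- the backward point of `x′` and the base points of the cell pair
  have e0 : (scShift' d L mv kk r hL μ).symm x' + unitVec (fine (L ^ r * L ^ kk) (cvM d L mv kk hL)) μ = x' := by rw [scShift'_symm_eq_sub, sub_add_cancel]
  have hm0x : (∃ y ∈ cvSk d L mv kk hL k, (unitTorusGeo L kk (cvM d L mv kk hL)).dist (scBlk' d L mv kk r hL ((scShift' d L mv kk r hL μ).symm x')) y ≤ 1) := by
    have h0 : (∃ y ∈ cvSk d L mv kk hL k, (unitTorusGeo L kk (cvM d L mv kk hL)).dist (scBlk' d L mv kk r hL x') y ≤ 0) := ⟨_, hB0, by rw [hblk]; exact le_of_eq (tdistT_self _ _)⟩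
    have h := exists_tdist_le_succ (tdist_scBlk'_scShift'_symm_le (d := d) (L := L) (mv := mv) (kk := kk) (r := r) (hL := hL) μ x') h0
    rw [zero_add] at h
    exact h
  have hm0σ : (∃ y ∈ cvSk d L mv kk hL k, (unitTorusGeo L kk (cvM d L mv kk hL)).dist (scBlk' d L mv kk r hL ((scShift' d L mv kk r hL μ).symm (kingSec (cvM d L mv kk hL) L kk r (kingPr L kk r (cvM d L mv kk hL) x')))) y ≤ 1) := by
    have h0 : (∃ y ∈ cvSk d L mv kk hL k, (unitTorusGeo L kk (cvM d L mv kk hL)).dist (scBlk' d L mv kk r hL (kingSec (cvM d L mv kk hL) L kk r (kingPr L kk r (cvM d L mv kk hL) x'))) y ≤ 0) := ⟨_, hB0, by rw [hblk, kingPr_kingSec]; exact le_of_eq (tdistT_self _ _)⟩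
    have h := exists_tdist_le_succ (tdist_scBlk'_scShift'_symm_le (d := d) (L := L) (mv := mv) (kk := kk) (r := r) (hL := hL) μ _) h0
    rw [zero_add] at h
    exact h
  -- the pair geometry: the cell pair `(x′ − e′, σy − e′)` is `≤ 1 + (L^r − 1) + 1 ≤ 2L^r` apart
  have hdistC : tdistT (fine (L ^ r * L ^ kk) (cvM d L mv kk hL)) ((scShift' d L mv kk r hL μ).symm x') ((scShift' d L mv kk r hL μ).symm (kingSec (cvM d L mv kk hL) L kk r (kingPr L kk r (cvM d L mv kk hL) x'))) ≤ 2 * ((L ^ r : ℕ) : ℝ) := by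
    rw [scShift'_symm_eq_sub, scShift'_symm_eq_sub]
    have h1 : tdistT (fine (L ^ r * L ^ kk) (cvM d L mv kk hL)) (x' - unitVec (fine (L ^ r * L ^ kk) (cvM d L mv kk hL)) μ) x' ≤ 1 := by
      rw [tdistT_symm]; exact tdistT_sub_unitVec_le _ x' μ
    have h2 : tdistT (fine (L ^ r * L ^ kk) (cvM d L mv kk hL)) x' (kingSec (cvM d L mv kk hL) L kk r (kingPr L kk r (cvM d L mv kk hL) x')) ≤ ((L ^ r : ℕ) : ℝ) - 1 :=
      tdistT_le_of_kingPr_eq (L := L) (M := cvM d L mv kk hL) (m := r) (k := kk) (by rw [kingPr_kingSec])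
    have h3 : tdistT (fine (L ^ r * L ^ kk) (cvM d L mv kk hL)) (kingSec (cvM d L mv kk hL) L kk r (kingPr L kk r (cvM d L mv kk hL) x')) (kingSec (cvM d L mv kk hL) L kk r (kingPr L kk r (cvM d L mv kk hL) x') - unitVec (fine (L ^ r * L ^ kk) (cvM d L mv kk hL)) μ) ≤ 1 :=
      tdistT_sub_unitVec_le _ _ μ
    have t1 := tdistT_triangle (fine (L ^ r * L ^ kk) (cvM d L mv kk hL)) (x' - unitVec (fine (L ^ r * L ^ kk) (cvM d L mv kk hL)) μ) x' (kingSec (cvM d L mv kk hL) L kk r (kingPr L kk r (cvM d L mv kk hL) x') - unitVec (fine (L ^ r * L ^ kk) (cvM d L mv kk hL)) μ)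
    have t2 := tdistT_triangle (fine (L ^ r * L ^ kk) (cvM d L mv kk hL)) x' (kingSec (cvM d L mv kk hL) L kk r (kingPr L kk r (cvM d L mv kk hL) x')) (kingSec (cvM d L mv kk hL) L kk r (kingPr L kk r (cvM d L mv kk hL) x') - unitVec (fine (L ^ r * L ^ kk) (cvM d L mv kk hL)) μ)
    have hN1r : (1 : ℝ) ≤ ((L ^ r : ℕ) : ℝ) := by exact_mod_cast hN1
    linarith
  -- the line pairs are `≤ 2L^r` apart
  have hdistL : ∀ t t', t < 2 * L ^ r → t' < 2 * L ^ r →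
      tdistT (fine (L ^ r * L ^ kk) (cvM d L mv kk hL)) (kingSec (cvM d L mv kk hL) L kk r ((scShift d L mv kk hL μ).symm (kingPr L kk r (cvM d L mv kk hL) x')) + t • unitVec (fine (L ^ r * L ^ kk) (cvM d L mv kk hL)) μ)
        (kingSec (cvM d L mv kk hL) L kk r ((scShift d L mv kk hL μ).symm (kingPr L kk r (cvM d L mv kk hL) x')) + t' • unitVec (fine (L ^ r * L ^ kk) (cvM d L mv kk hL)) μ) ≤ 2 * ((L ^ r : ℕ) : ℝ) := by
    intro t t' ht ht'
    wlog hle : t ≤ t' generalizing t t'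
    · rw [tdistT_symm]; exact this t' t ht' ht (le_of_not_ge hle)
    obtain ⟨s, rfl⟩ := Nat.exists_eq_add_of_le hle
    rw [add_smul, ← add_assoc]
    refine (tdistT_add_smul_unitVec_le (L ^ r * L ^ kk) (cvM d L mv kk hL) _ μ s).trans ?_
    exact_mod_cast (show s ≤ 2 * L ^ r by omega)
  -- the cell oscillation `ω = (d+1)(L^r−1)η′²q` from the step letter on the King cell of `x′` (n15-c∕345)
  obtain ⟨hc0, -, -⟩ := sc_cell_tdist_le hM hm₁ hfitI hS0 k μ x' hχ
  have hω := norm_sub_kingSec_kingPr_le (cvM d L mv kk hL) L kk r W hη2q x' (fun i z hz => hF2 k i μ z (hc0 z hz))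
  refine abs_divergenceFit_entry_le_of_pairwise e (hu' k) hU' μ (hpair μ) W (fun z => rfl) hp hq hG (by positivity) x'
    (fun t ht => ?_) (fun t t' ht ht' => ?_) ?_ ?_ hω i j
  · have h3 := hmono _ 1 3 (by norm_num) (hlineP t ht)
    exact ⟨hF1 k μ _ h3, hF2 k μ μ _ h3⟩
  · exact hH k μ _ _ (hmono _ 1 3 (by norm_num) (hlineP t (by omega))) (hmono _ 1 3 (by norm_num) (hlineP t' (by omega))) (hdistL t t' (by omega) (by omega))
  · exact hH k μ _ _ (hmono _ 1 3 (by norm_num) hm0x) (hmono _ 1 3 (by norm_num) hm0σ) hdistC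
  · exact hF2 k μ μ _ (hmono _ 1 3 (by norm_num) hm0x)

end Cubes

end Summit.QuantumFields.YangMills.BalabanUVNodes.N15.Gluing

end
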